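import Literature.NumberTheory.Sieve.VaughanMeanValueDecomposition
import Literature.NumberTheory.EllipticCurves.LFunctionCoefficientBoundExplicit
import Mathlib.Analysis.PSeries
import HarnessLib

/-!
# Conrey–Iwaniec (2002), proof of Theorem 4.1: the elementary sums over the moduli `c`

B. Conrey, H. Iwaniec, *Spacing of zeros of Hecke `L`-functions and the class number problem*,
Acta Arith. 103 (2002) 259–312, §4, proof of Theorem 4.1 [held text `paper:arxiv-math_0111012`,
p0011:L27–60]. After the incomplete Kloosterman sums (4.14) are estimated by
`τ(c)(h,c)^{1/2}c^{1/2} log C`, the error term `R` of the circle method is a sum over the moduli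
`c ≤ C` of `(h,c)^{1/2}c^{-1/2}τ(c)` (twice) and the leading term needs `Σ_{c ≤ C}(h,c)c^{-1}`
(extension of the `α`-integral) and the tail `Σ_{c > C} r_c(h)p(c)² ≪ τ(h)A²C^{-1}`
(`|r_c(h)| ≤ (h,c)`, `p(c) ≤ A/c`). This file proves the four elementary bounds, with absolute
constants, in the shape the assembly of Theorem 4.1 (registered stub S3b3 `stub_circle_assembly`
of SKELETON S3, cell `landau-siegel/ls-inputs`, line `theta-circle-method`) consumes:

* `sum_card_divisors_div_sqrt_le`: `Σ_{c ≤ Y} τ(c)/√c ≤ 2√Y(1 + log Y)` (hyperbola);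
* `sum_card_divisors_sqrt_gcd_div_sqrt_le`: `Σ_{c ≤ C} τ(c)√(h,c)/√c ≤ 4τ(h)√C(1 + log C)`
  (group by `d = (h,c)`, `τ(dc') ≤ τ(d)τ(c')`, and `τ(d) ≤ 2√d`);
* `sum_gcd_div_le`: `Σ_{c ≤ C} (h,c)/c ≤ τ(h)(1 + log C)`;
* `sum_gcd_div_sq_tail_le`: `Σ_{C < c ≤ N} (h,c)/c² ≤ 2τ(h)/C`;
* `summable_card_divisors_mul_rpow`, `tsum_card_divisors_mul_rpow_le`: `Σ_m τ(m)m^{-5/4} ≤ (Σ_n n^{-5/4})²`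
  (`Σ_n n^{-5/4}`), used with (4.4)–(4.5): `Σ_{m ≥ 1}|ψ_m(a)ĝ_m(α)| ≤ (A/c)·BcC·(Σ_n n^{-5/4})²`.

Print states these steps without proof ("To estimate `R` we apply (4.8) and (4.9) getting …";
"Finally we extend the summation over `c ≤ C` to all `c` getting
`Σ_{c ≤ C} r_c(h)p(c)² = σ(h) + O(τ(h)A²C^{-1})`").

## References

* [ConreyIwaniec2002] B. Conrey, H. Iwaniec, Acta Arith. 103 (2002) 259–312, arXiv:math/0111012:
  §4, proof of Theorem 4.1 (p. 269–270).
* [HardyWright2008] G. H. Hardy, E. M. Wright, *An introduction to the theory of numbers*,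
  6th ed., §18.1 (`d(n) < 2√n`).
-/

noncomputable section

open Finset Real

namespace Literature.NumberTheory.LFunctions

namespace ConreyIwaniec2002

namespace CircleMethod

open Literature.NumberTheory.Sieve.Vaughan (card_divisors_mul_le sum_Ioc_inv_le
  sum_Ioc_sum_divisorsAntidiagonal_eq card_divisors_eq_sum_antidiagonal)

/-! ### One-variable sums -/

/-- `τ(n) ≤ 2√n` (real form of the tree's `Nat.card_divisors_le_two_mul_sqrt`: "it is trivial
that `d(n) < 2√n`"). [cite: HardyWright2008, §18.1 Theorem 315 (proof)] -/
theorem card_divisors_le_two_mul_sqrt (n : ℕ) : (n.divisors.card : ℝ) ≤ 2 * Real.sqrt n := by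
  calc (n.divisors.card : ℝ) ≤ ((2 * Nat.sqrt n : ℕ) : ℝ) := by
        exact_mod_cast Nat.card_divisors_le_two_mul_sqrt n
    _ = 2 * (Nat.sqrt n : ℝ) := by push_cast; ring
    _ ≤ 2 * Real.sqrt n := by gcongr; exact Real.nat_sqrt_le_real_sqrt

/-- `Σ_{1 ≤ f ≤ N} 1/√f ≤ 2√N`. [folklore] -/
private theorem sum_Ioc_inv_sqrt_le (N : ℕ) : ∑ f ∈ Ioc 0 N, (Real.sqrt f)⁻¹ ≤ 2 * Real.sqrt N := by
  induction N with
  | zero => simp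
  | succ N ih =>
    rw [Finset.sum_Ioc_succ_top (Nat.zero_le _)]
    have hb : 0 < Real.sqrt ((N + 1 : ℕ) : ℝ) := Real.sqrt_pos.mpr (by positivity)
    set a := Real.sqrt (N : ℝ) with ha
    set b := Real.sqrt ((N + 1 : ℕ) : ℝ) with hbdef
    have ha0 : 0 ≤ a := Real.sqrt_nonneg _
    have hsq : b ^ 2 - a ^ 2 = 1 := by
      rw [hbdef, ha, Real.sq_sqrt (by positivity), Real.sq_sqrt (by positivity)]
      push_cast; ring
    -- `1/b ≤ 2(b - a)` since `2b(b-a) ≥ b² - a² = 1`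
    have key : b⁻¹ ≤ 2 * b - 2 * a := by
      rw [inv_le_iff_one_le_mul₀ hb]
      nlinarith [sq_nonneg (b - a)]
    linarith

/-- `Σ_{a < c ≤ N} 1/c² ≤ 1/a` for `a ≥ 1` (telescoping `1/c² ≤ 1/(c-1) − 1/c`). [folklore] -/
private theorem sum_Ioc_inv_sq_le {a : ℕ} (ha : 1 ≤ a) (N : ℕ) :
    ∑ c ∈ Ioc a N, ((c : ℝ) ^ 2)⁻¹ ≤ (a : ℝ)⁻¹ := by
  rcases le_or_gt a N with haN | haN
  · -- stronger claim with the telescoped remainder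
    suffices h : ∑ c ∈ Ioc a N, ((c : ℝ) ^ 2)⁻¹ ≤ (a : ℝ)⁻¹ - (N : ℝ)⁻¹ by
      have : (0 : ℝ) ≤ (N : ℝ)⁻¹ := by positivity
      linarith
    induction N, haN using Nat.le_induction with
    | base => simp
    | succ N hN ih =>
      rw [Finset.sum_Ioc_succ_top (by omega)]
      have hN0 : (0 : ℝ) < N := by exact_mod_cast (show 0 < N by omega)
      have hstep : (((N + 1 : ℕ) : ℝ) ^ 2)⁻¹ ≤ (N : ℝ)⁻¹ - ((N + 1 : ℕ) : ℝ)⁻¹ := by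
        push_cast
        rw [show (N : ℝ)⁻¹ - ((N : ℝ) + 1)⁻¹ = ((N : ℝ) * (N + 1))⁻¹ by field_simp; ring]
        exact inv_anti₀ (by positivity) (by nlinarith)
      linarith
  · rw [Finset.Ioc_eq_empty (by omega), Finset.sum_empty]
    positivity

/-- `Σ_{c ≤ Y} τ(c)/√c ≤ 2√Y(1 + log Y)` (Dirichlet's hyperbola: `τ(c)/√c = Σ_{ef = c}(ef)^{-1/2}`,
`Σ_{f ≤ Y/e} f^{-1/2} ≤ 2√(Y/e)`, `Σ_{e ≤ Y} 1/e ≤ 1 + log Y`). [folklore] -/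
private theorem sum_card_divisors_div_sqrt_le (Y : ℕ) :
    ∑ c ∈ Ioc 0 Y, (c.divisors.card : ℝ) / Real.sqrt c ≤ 2 * Real.sqrt Y * (1 + Real.log Y) := by
  have h1 : ∀ c ∈ Ioc 0 Y, (c.divisors.card : ℝ) / Real.sqrt c =
      ∑ x ∈ c.divisorsAntidiagonal, (Real.sqrt x.1)⁻¹ * (Real.sqrt x.2)⁻¹ := by
    intro c _
    rw [card_divisors_eq_sum_antidiagonal, Finset.sum_div]
    refine Finset.sum_congr rfl fun x hx ↦ ?_
    rw [Nat.mem_divisorsAntidiagonal] at hx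
    rw [← hx.1, Nat.cast_mul, Real.sqrt_mul (Nat.cast_nonneg _), ← mul_inv, one_div]
  rw [Finset.sum_congr rfl h1,
    sum_Ioc_sum_divisorsAntidiagonal_eq (fun e f ↦ (Real.sqrt e)⁻¹ * (Real.sqrt f)⁻¹) Y]
  have hY : 0 ≤ 1 + Real.log Y := by
    rcases Nat.eq_zero_or_pos Y with rfl | hY
    · simp
    · have := Real.log_nonneg (show (1 : ℝ) ≤ Y by exact_mod_cast hY); linarith
  calc ∑ e ∈ Ioc 0 Y, ∑ f ∈ Ioc 0 (Y / e), (Real.sqrt e)⁻¹ * (Real.sqrt f)⁻¹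
      ≤ ∑ e ∈ Ioc 0 Y, (Real.sqrt e)⁻¹ * (2 * Real.sqrt ((Y / e : ℕ) : ℝ)) := by
        refine Finset.sum_le_sum fun e _ ↦ ?_
        rw [← Finset.mul_sum]
        exact mul_le_mul_of_nonneg_left (sum_Ioc_inv_sqrt_le _) (by positivity)
    _ ≤ ∑ e ∈ Ioc 0 Y, 2 * Real.sqrt Y * ((e : ℝ))⁻¹ := by
        refine Finset.sum_le_sum fun e he ↦ ?_
        rw [Finset.mem_Ioc] at he
        have he0 : (0 : ℝ) < e := by exact_mod_cast he.1
        have hdiv : ((Y / e : ℕ) : ℝ) ≤ (Y : ℝ) / e := Nat.cast_div_le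
        have hs : Real.sqrt ((Y / e : ℕ) : ℝ) ≤ Real.sqrt Y / Real.sqrt e := by
          rw [← Real.sqrt_div' _ he0.le]
          exact Real.sqrt_le_sqrt hdiv
        have hse : 0 < Real.sqrt e := Real.sqrt_pos.mpr he0
        calc (Real.sqrt e)⁻¹ * (2 * Real.sqrt ((Y / e : ℕ) : ℝ))
            ≤ (Real.sqrt e)⁻¹ * (2 * (Real.sqrt Y / Real.sqrt e)) := by gcongr
          _ = 2 * Real.sqrt Y * ((Real.sqrt e) ^ 2)⁻¹ := by field_simp
          _ = 2 * Real.sqrt Y * ((e : ℝ))⁻¹ := by rw [Real.sq_sqrt he0.le]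
    _ = 2 * Real.sqrt Y * ∑ e ∈ Ioc 0 Y, ((e : ℝ))⁻¹ := by rw [Finset.mul_sum]
    _ ≤ 2 * Real.sqrt Y * (1 + Real.log Y) :=
        mul_le_mul_of_nonneg_left (sum_Ioc_inv_le Y) (by positivity)

/-! ### Sums weighted by `(h, c)`: grouping by the value of the gcd -/

/-- The map `c ↦ ((h,c), c/(h,c))` is injective. [folklore] -/
private theorem injOn_gcd_div (h : ℕ) (s : Finset ℕ) :
    Set.InjOn (fun c : ℕ ↦ (Nat.gcd h c, c / Nat.gcd h c)) (s : Set ℕ) := by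
  intro c₁ _ c₂ _ hc
  simp only [Prod.mk.injEq] at hc
  have e₁ : Nat.gcd h c₁ * (c₁ / Nat.gcd h c₁) = c₁ := Nat.mul_div_cancel' (Nat.gcd_dvd_right h c₁)
  have e₂ : Nat.gcd h c₂ * (c₂ / Nat.gcd h c₂) = c₂ := Nat.mul_div_cancel' (Nat.gcd_dvd_right h c₂)
  calc c₁ = Nat.gcd h c₁ * (c₁ / Nat.gcd h c₁) := e₁.symm
    _ = Nat.gcd h c₂ * (c₂ / Nat.gcd h c₂) := by rw [hc.2, hc.1]
    _ = c₂ := e₂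

/-- **Grouping by `d = (h, c)`**: for `G ≥ 0`,
`Σ_{c ∈ s} G((h,c), c/(h,c)) ≤ Σ_{d ∣ h} Σ_{c' ∈ t, P d c'} G(d, c')` as soon as every
`((h,c), c/(h,c))`, `c ∈ s`, lies in the target set. [folklore] -/
private theorem sum_le_sum_gcd_fibres {h : ℕ} (s : Finset ℕ) (T : Finset (ℕ × ℕ)) (G : ℕ × ℕ → ℝ)
    (hG : ∀ p ∈ T, 0 ≤ G p)
    (hmem : ∀ c ∈ s, (Nat.gcd h c, c / Nat.gcd h c) ∈ T) :
    ∑ c ∈ s, G (Nat.gcd h c, c / Nat.gcd h c) ≤ ∑ p ∈ T, G p := by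
  classical
  rw [← Finset.sum_image (injOn_gcd_div h s)]
  refine Finset.sum_le_sum_of_subset_of_nonneg (fun p hp ↦ ?_) (fun p hp _ ↦ hG p hp)
  rw [Finset.mem_image] at hp
  obtain ⟨c, hc, rfl⟩ := hp
  exact hmem c hc

/-- `Σ_{c ≤ C} τ(c)√(h,c)/√c ≤ 4τ(h)√C(1 + log C)` for `h ≠ 0`: writing `c = dc'` with
`d = (h,c)`, `τ(c)√d/√c ≤ τ(d)τ(c')/√c'`, the inner sums are `≤ 2√(C/d)(1 + log C)`
(`sum_card_divisors_div_sqrt_le`) and `Σ_{d ∣ h} τ(d)/√d ≤ 2τ(h)` (`τ(d) ≤ 2√d`). This is the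
sum "`Σ_{c ≤ C}(h,c)^{1/2}c^{-1/2}τ(c)`" of the error term `R` in the proof of Theorem 4.1.
[cite: ConreyIwaniec2002, §4, proof of Theorem 4.1 (estimate of `R`)] -/
theorem sum_card_divisors_sqrt_gcd_div_sqrt_le {h : ℕ} (hh : h ≠ 0) (C : ℕ) :
    ∑ c ∈ Ioc 0 C, (c.divisors.card : ℝ) * Real.sqrt (Nat.gcd h c) / Real.sqrt c ≤
      4 * (h.divisors.card : ℝ) * Real.sqrt C * (1 + Real.log C) := by
  classical
  rcases Nat.eq_zero_or_pos C with rfl | hC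
  · simp
  have hlogC : 0 ≤ Real.log C := Real.log_nonneg (by exact_mod_cast hC)
  -- target set and majorant
  set T : Finset (ℕ × ℕ) := (h.divisors ×ˢ Ioc 0 C).filter (fun p ↦ p.1 * p.2 ≤ C) with hT
  set G : ℕ × ℕ → ℝ := fun p ↦ (p.1.divisors.card : ℝ) * ((p.2.divisors.card : ℝ) / Real.sqrt p.2)
    with hGdef
  have hG0 : ∀ p ∈ T, 0 ≤ G p := fun p _ ↦ by positivity
  -- termwise comparison
  have hterm : ∀ c ∈ Ioc 0 C, (c.divisors.card : ℝ) * Real.sqrt (Nat.gcd h c) / Real.sqrt c ≤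
      G (Nat.gcd h c, c / Nat.gcd h c) := by
    intro c hc
    rw [Finset.mem_Ioc] at hc
    set d := Nat.gcd h c with hd
    set c' := c / d with hc'
    have hd0 : 0 < d := Nat.gcd_pos_of_pos_right h hc.1
    have hdc : d * c' = c := Nat.mul_div_cancel' (Nat.gcd_dvd_right h c)
    have hc'0 : 0 < c' := Nat.pos_of_ne_zero fun h0 ↦ by rw [h0, mul_zero] at hdc; omega
    have hd' : (0 : ℝ) < d := by exact_mod_cast hd0
    have hc'' : (0 : ℝ) < c' := by exact_mod_cast hc'0
    have hτ : (c.divisors.card : ℝ) ≤ (d.divisors.card : ℝ) * c'.divisors.card := by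
      rw [← hdc]; exact_mod_cast card_divisors_mul_le d c'
    have hsqrt : Real.sqrt c = Real.sqrt d * Real.sqrt c' := by
      rw [← hdc, Nat.cast_mul, Real.sqrt_mul hd'.le]
    have hsd : 0 < Real.sqrt d := Real.sqrt_pos.mpr hd'
    have hsc : 0 < Real.sqrt c' := Real.sqrt_pos.mpr hc''
    simp only [hGdef]
    rw [hsqrt, div_le_iff₀ (by positivity)]
    calc (c.divisors.card : ℝ) * Real.sqrt d
        ≤ (d.divisors.card : ℝ) * c'.divisors.card * Real.sqrt d := by gcongr
      _ = (d.divisors.card : ℝ) * (c'.divisors.card / Real.sqrt c') * (Real.sqrt d * Real.sqrt c') := by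
          field_simp
  have hmem : ∀ c ∈ Ioc 0 C, (Nat.gcd h c, c / Nat.gcd h c) ∈ T := by
    intro c hc
    rw [Finset.mem_Ioc] at hc
    have hd0 : 0 < Nat.gcd h c := Nat.gcd_pos_of_pos_right h hc.1
    have hdc : Nat.gcd h c * (c / Nat.gcd h c) = c := Nat.mul_div_cancel' (Nat.gcd_dvd_right h c)
    have hc'0 : 0 < c / Nat.gcd h c :=
      Nat.pos_of_ne_zero fun h0 ↦ by rw [h0, mul_zero] at hdc; omega
    simp only [hT, Finset.mem_filter, Finset.mem_product, Nat.mem_divisors, Finset.mem_Ioc]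
    exact ⟨⟨⟨Nat.gcd_dvd_left h c, hh⟩, hc'0, (Nat.div_le_self _ _).trans hc.2⟩, by rw [hdc]; exact hc.2⟩
  -- the double sum over the target set
  have hTsum : ∑ p ∈ T, G p =
      ∑ d ∈ h.divisors, (d.divisors.card : ℝ) *
        ∑ c' ∈ Ioc 0 (C / d), (c'.divisors.card : ℝ) / Real.sqrt c' := by
    rw [hT, Finset.sum_filter, Finset.sum_product]
    refine Finset.sum_congr rfl fun d hd ↦ ?_
    have hd0 : 0 < d := Nat.pos_of_mem_divisors hd
    rw [Finset.mul_sum, ← Finset.sum_filter]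
    refine Finset.sum_congr ?_ fun _ _ ↦ rfl
    ext c'
    simp only [Finset.mem_filter, Finset.mem_Ioc, Nat.le_div_iff_mul_le hd0]
    constructor
    · rintro ⟨⟨h1, -⟩, h2⟩; exact ⟨h1, by rwa [mul_comm] at h2⟩
    · rintro ⟨h1, h2⟩
      refine ⟨⟨h1, ?_⟩, by rwa [mul_comm]⟩
      calc c' ≤ c' * d := Nat.le_mul_of_pos_right _ hd0
        _ ≤ C := h2
  calc ∑ c ∈ Ioc 0 C, (c.divisors.card : ℝ) * Real.sqrt (Nat.gcd h c) / Real.sqrt c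
      ≤ ∑ c ∈ Ioc 0 C, G (Nat.gcd h c, c / Nat.gcd h c) := Finset.sum_le_sum hterm
    _ ≤ ∑ p ∈ T, G p := sum_le_sum_gcd_fibres _ T G hG0 hmem
    _ = _ := hTsum
    _ ≤ ∑ d ∈ h.divisors, (d.divisors.card : ℝ) *
          (2 * Real.sqrt ((C / d : ℕ) : ℝ) * (1 + Real.log ((C / d : ℕ) : ℝ))) := by
        refine Finset.sum_le_sum fun d _ ↦ ?_
        exact mul_le_mul_of_nonneg_left (sum_card_divisors_div_sqrt_le _) (Nat.cast_nonneg _)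
    _ ≤ ∑ d ∈ h.divisors, 2 * (2 * Real.sqrt C * (1 + Real.log C)) := by
        refine Finset.sum_le_sum fun d hd ↦ ?_
        have hd0 : 0 < d := Nat.pos_of_mem_divisors hd
        have hd' : (0 : ℝ) < d := by exact_mod_cast hd0
        -- `τ(d) ≤ 2√d`, `√⌊C/d⌋ ≤ √C/√d`, `log ⌊C/d⌋ ≤ log C`
        have hτd : (d.divisors.card : ℝ) ≤ 2 * Real.sqrt d := card_divisors_le_two_mul_sqrt d
        have hsq : Real.sqrt ((C / d : ℕ) : ℝ) ≤ Real.sqrt C / Real.sqrt d := by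
          rw [← Real.sqrt_div' _ hd'.le]
          exact Real.sqrt_le_sqrt Nat.cast_div_le
        have hlog : Real.log ((C / d : ℕ) : ℝ) ≤ Real.log C := by
          rcases Nat.eq_zero_or_pos (C / d) with h0 | hpos
          · rw [h0, Nat.cast_zero, Real.log_zero]; exact hlogC
          · exact Real.log_le_log (by exact_mod_cast hpos) (by exact_mod_cast Nat.div_le_self C d)
        have hsd : 0 < Real.sqrt d := Real.sqrt_pos.mpr hd'
        have hl0 : 0 ≤ 1 + Real.log ((C / d : ℕ) : ℝ) := by
          rcases Nat.eq_zero_or_pos (C / d) with h0 | hpos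
          · rw [h0, Nat.cast_zero, Real.log_zero]; norm_num
          · have := Real.log_nonneg (show (1 : ℝ) ≤ (C / d : ℕ) by exact_mod_cast hpos); linarith
        calc (d.divisors.card : ℝ) * (2 * Real.sqrt ((C / d : ℕ) : ℝ) * (1 + Real.log ((C / d : ℕ) : ℝ)))
            ≤ (2 * Real.sqrt d) * (2 * (Real.sqrt C / Real.sqrt d) * (1 + Real.log C)) := by
              gcongr
          _ = 2 * (2 * Real.sqrt C * (1 + Real.log C)) := by field_simp
    _ = 4 * (h.divisors.card : ℝ) * Real.sqrt C * (1 + Real.log C) := by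
        rw [Finset.sum_const, nsmul_eq_mul]; ring

/-- `Σ_{c ≤ C} (h,c)/c ≤ τ(h)(1 + log C)` for `h ≠ 0` (group by `d = (h,c)`: the inner sums are
harmonic sums `Σ_{c' ≤ C/d} 1/c'`). Used for the extension of the `α`-integral in the leading
term of Theorem 4.1 (`|r_c(h)| ≤ (h,c)`, `p(c) ≤ A/c`).
[cite: ConreyIwaniec2002, §4, proof of Theorem 4.1 (leading term)] -/
theorem sum_gcd_div_le {h : ℕ} (hh : h ≠ 0) (C : ℕ) :
    ∑ c ∈ Ioc 0 C, (Nat.gcd h c : ℝ) / c ≤ (h.divisors.card : ℝ) * (1 + Real.log C) := by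
  classical
  rcases Nat.eq_zero_or_pos C with rfl | hC
  · simp
  have hlogC : 0 ≤ Real.log C := Real.log_nonneg (by exact_mod_cast hC)
  set T : Finset (ℕ × ℕ) := (h.divisors ×ˢ Ioc 0 C).filter (fun p ↦ p.1 * p.2 ≤ C) with hT
  set G : ℕ × ℕ → ℝ := fun p ↦ ((p.2 : ℝ))⁻¹ with hGdef
  have hG0 : ∀ p ∈ T, 0 ≤ G p := fun p _ ↦ by positivity
  have hterm : ∀ c ∈ Ioc 0 C, (Nat.gcd h c : ℝ) / c = G (Nat.gcd h c, c / Nat.gcd h c) := by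
    intro c hc
    rw [Finset.mem_Ioc] at hc
    have hd0 : 0 < Nat.gcd h c := Nat.gcd_pos_of_pos_right h hc.1
    have hdc : Nat.gcd h c * (c / Nat.gcd h c) = c := Nat.mul_div_cancel' (Nat.gcd_dvd_right h c)
    have hc'0 : 0 < c / Nat.gcd h c :=
      Nat.pos_of_ne_zero fun h0 ↦ by rw [h0, mul_zero] at hdc; omega
    simp only [hGdef]
    have hd' : (Nat.gcd h c : ℝ) ≠ 0 := by positivity
    rw [show (c : ℝ) = (Nat.gcd h c : ℝ) * ((c / Nat.gcd h c : ℕ) : ℝ) by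
      rw [← Nat.cast_mul, hdc]]
    field_simp
  have hmem : ∀ c ∈ Ioc 0 C, (Nat.gcd h c, c / Nat.gcd h c) ∈ T := by
    intro c hc
    rw [Finset.mem_Ioc] at hc
    have hd0 : 0 < Nat.gcd h c := Nat.gcd_pos_of_pos_right h hc.1
    have hdc : Nat.gcd h c * (c / Nat.gcd h c) = c := Nat.mul_div_cancel' (Nat.gcd_dvd_right h c)
    have hc'0 : 0 < c / Nat.gcd h c :=
      Nat.pos_of_ne_zero fun h0 ↦ by rw [h0, mul_zero] at hdc; omega
    simp only [hT, Finset.mem_filter, Finset.mem_product, Nat.mem_divisors, Finset.mem_Ioc]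
    exact ⟨⟨⟨Nat.gcd_dvd_left h c, hh⟩, hc'0, (Nat.div_le_self _ _).trans hc.2⟩, by rw [hdc]; exact hc.2⟩
  have hTsum : ∑ p ∈ T, G p = ∑ d ∈ h.divisors, ∑ c' ∈ Ioc 0 (C / d), ((c' : ℝ))⁻¹ := by
    rw [hT, Finset.sum_filter, Finset.sum_product]
    refine Finset.sum_congr rfl fun d hd ↦ ?_
    have hd0 : 0 < d := Nat.pos_of_mem_divisors hd
    rw [← Finset.sum_filter]
    refine Finset.sum_congr ?_ fun _ _ ↦ rfl
    ext c'
    simp only [Finset.mem_filter, Finset.mem_Ioc, Nat.le_div_iff_mul_le hd0]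
    constructor
    · rintro ⟨⟨h1, -⟩, h2⟩; exact ⟨h1, by rwa [mul_comm] at h2⟩
    · rintro ⟨h1, h2⟩
      refine ⟨⟨h1, ?_⟩, by rwa [mul_comm]⟩
      calc c' ≤ c' * d := Nat.le_mul_of_pos_right _ hd0
        _ ≤ C := h2
  calc ∑ c ∈ Ioc 0 C, (Nat.gcd h c : ℝ) / c
      = ∑ c ∈ Ioc 0 C, G (Nat.gcd h c, c / Nat.gcd h c) := Finset.sum_congr rfl hterm
    _ ≤ ∑ p ∈ T, G p := sum_le_sum_gcd_fibres _ T G hG0 hmem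
    _ = _ := hTsum
    _ ≤ ∑ d ∈ h.divisors, (1 + Real.log C) := by
        refine Finset.sum_le_sum fun d hd ↦ (sum_Ioc_inv_le _).trans ?_
        rcases Nat.eq_zero_or_pos (C / d) with h0 | hpos
        · rw [h0, Nat.cast_zero, Real.log_zero]; linarith
        · have := Real.log_le_log (by exact_mod_cast hpos)
            (show ((C / d : ℕ) : ℝ) ≤ C by exact_mod_cast Nat.div_le_self C d)
          linarith
    _ = (h.divisors.card : ℝ) * (1 + Real.log C) := by rw [Finset.sum_const, nsmul_eq_mul]

/-- `Σ_{C < c ≤ N} (h,c)/c² ≤ 2τ(h)/C` for `h ≠ 0`, `C ≥ 1` (group by `d = (h,c)`: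
`Σ_{c' > C/d} 1/c'² ≤ 2d/C`). This is the tail "`Σ_{c ≤ C} r_c(h)p(c)² = σ(h) + O(τ(h)A²C^{-1})`"
of the proof of Theorem 4.1 (`|r_c(h)| ≤ (h,c)`, `p(c) ≤ A/c`).
[cite: ConreyIwaniec2002, §4, proof of Theorem 4.1 ((4.16) and the line before)] -/
theorem sum_gcd_div_sq_tail_le {h : ℕ} (hh : h ≠ 0) {C : ℕ} (hC : 1 ≤ C) (N : ℕ) :
    ∑ c ∈ Ioc C N, (Nat.gcd h c : ℝ) / (c : ℝ) ^ 2 ≤ 2 * (h.divisors.card : ℝ) / C := by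
  classical
  have hC' : (0 : ℝ) < C := by exact_mod_cast hC
  set T : Finset (ℕ × ℕ) := (h.divisors ×ˢ Ioc 0 N).filter (fun p ↦ C < p.1 * p.2) with hT
  set G : ℕ × ℕ → ℝ := fun p ↦ ((p.1 : ℝ))⁻¹ * (((p.2 : ℝ)) ^ 2)⁻¹ with hGdef
  have hG0 : ∀ p ∈ T, 0 ≤ G p := fun p _ ↦ by positivity
  have hterm : ∀ c ∈ Ioc C N, (Nat.gcd h c : ℝ) / (c : ℝ) ^ 2 = G (Nat.gcd h c, c / Nat.gcd h c) := by
    intro c hc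
    rw [Finset.mem_Ioc] at hc
    have hc0 : 0 < c := lt_of_le_of_lt (Nat.zero_le _) hc.1
    have hd0 : 0 < Nat.gcd h c := Nat.gcd_pos_of_pos_right h hc0
    have hdc : Nat.gcd h c * (c / Nat.gcd h c) = c := Nat.mul_div_cancel' (Nat.gcd_dvd_right h c)
    have hc'0 : 0 < c / Nat.gcd h c :=
      Nat.pos_of_ne_zero fun h0 ↦ by rw [h0, mul_zero] at hdc; omega
    simp only [hGdef]
    have hd' : (Nat.gcd h c : ℝ) ≠ 0 := by positivity
    have hc'' : ((c / Nat.gcd h c : ℕ) : ℝ) ≠ 0 := by positivity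
    rw [show (c : ℝ) = (Nat.gcd h c : ℝ) * ((c / Nat.gcd h c : ℕ) : ℝ) by
      rw [← Nat.cast_mul, hdc]]
    field_simp
  have hmem : ∀ c ∈ Ioc C N, (Nat.gcd h c, c / Nat.gcd h c) ∈ T := by
    intro c hc
    rw [Finset.mem_Ioc] at hc
    have hc0 : 0 < c := lt_of_le_of_lt (Nat.zero_le _) hc.1
    have hdc : Nat.gcd h c * (c / Nat.gcd h c) = c := Nat.mul_div_cancel' (Nat.gcd_dvd_right h c)
    have hc'0 : 0 < c / Nat.gcd h c :=
      Nat.pos_of_ne_zero fun h0 ↦ by rw [h0, mul_zero] at hdc; omega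
    simp only [hT, Finset.mem_filter, Finset.mem_product, Nat.mem_divisors, Finset.mem_Ioc]
    exact ⟨⟨⟨Nat.gcd_dvd_left h c, hh⟩, hc'0, (Nat.div_le_self _ _).trans hc.2⟩, by rw [hdc]; exact hc.1⟩
  have hTsum : ∑ p ∈ T, G p =
      ∑ d ∈ h.divisors, ((d : ℝ))⁻¹ * ∑ c' ∈ Ioc (C / d) N, (((c' : ℝ)) ^ 2)⁻¹ := by
    rw [hT, Finset.sum_filter, Finset.sum_product]
    refine Finset.sum_congr rfl fun d hd ↦ ?_
    have hd0 : 0 < d := Nat.pos_of_mem_divisors hd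
    rw [Finset.mul_sum, ← Finset.sum_filter]
    refine Finset.sum_congr ?_ fun _ _ ↦ rfl
    ext c'
    simp only [Finset.mem_filter, Finset.mem_Ioc, Nat.div_lt_iff_lt_mul hd0]
    constructor
    · rintro ⟨⟨-, h2⟩, h3⟩; exact ⟨by rwa [mul_comm] at h3, h2⟩
    · rintro ⟨h1, h2⟩
      exact ⟨⟨Nat.pos_of_ne_zero fun h0 ↦ by rw [h0, zero_mul] at h1; omega, h2⟩,
        by rwa [mul_comm]⟩
  -- the inner tails
  have htail : ∀ d ∈ h.divisors, ∑ c' ∈ Ioc (C / d) N, (((c' : ℝ)) ^ 2)⁻¹ ≤ 2 * d / C := by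
    intro d hd
    have hd0 : 0 < d := Nat.pos_of_mem_divisors hd
    have hd' : (0 : ℝ) < d := by exact_mod_cast hd0
    rcases Nat.eq_zero_or_pos (C / d) with h0 | hpos
    · -- `d > C`: the full sum is `≤ 2 ≤ 2d/C`
      have hCd : C < d := by
        by_contra hle
        have := Nat.div_pos (not_lt.mp hle) hd0
        omega
      rw [h0]
      have h2 : ∑ c' ∈ Ioc 0 N, (((c' : ℝ)) ^ 2)⁻¹ ≤ 2 := by
        rcases Nat.eq_zero_or_pos N with rfl | hN
        · simp
        · rw [← Finset.sum_Ioc_consecutive _ (Nat.zero_le 1) hN,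
            show Ioc 0 1 = {1} by rfl, Finset.sum_singleton]
          have := sum_Ioc_inv_sq_le (le_refl 1) N
          norm_num at this ⊢
          linarith
      calc ∑ c' ∈ Ioc 0 N, (((c' : ℝ)) ^ 2)⁻¹ ≤ 2 := h2
        _ ≤ 2 * d / C := by
            rw [le_div_iff₀ hC']
            have : (C : ℝ) ≤ d := by exact_mod_cast hCd.le
            nlinarith
    · calc ∑ c' ∈ Ioc (C / d) N, (((c' : ℝ)) ^ 2)⁻¹ ≤ (((C / d : ℕ) : ℝ))⁻¹ :=
            sum_Ioc_inv_sq_le hpos N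
        _ ≤ 2 * d / C := by
            -- `C < d (⌊C/d⌋ + 1) ≤ 2 d ⌊C/d⌋`
            have h1 : C < d * (C / d) + d := by
              have := Nat.lt_div_mul_add (a := C) hd0
              rwa [mul_comm] at this
            have h2 : (C : ℝ) < 2 * d * ((C / d : ℕ) : ℝ) := by
              have h1' : (C : ℝ) < (d : ℝ) * ((C / d : ℕ) : ℝ) + d := by exact_mod_cast h1
              have hq1 : (1 : ℝ) ≤ ((C / d : ℕ) : ℝ) := by exact_mod_cast hpos
              nlinarith
            have hq0 : (0 : ℝ) < ((C / d : ℕ) : ℝ) := by exact_mod_cast hpos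
            rw [inv_le_iff_one_le_mul₀ hq0, div_mul_eq_mul_div, le_div_iff₀ hC']
            linarith
  calc ∑ c ∈ Ioc C N, (Nat.gcd h c : ℝ) / (c : ℝ) ^ 2
      = ∑ c ∈ Ioc C N, G (Nat.gcd h c, c / Nat.gcd h c) := Finset.sum_congr rfl hterm
    _ ≤ ∑ p ∈ T, G p := sum_le_sum_gcd_fibres _ T G hG0 hmem
    _ = _ := hTsum
    _ ≤ ∑ d ∈ h.divisors, ((d : ℝ))⁻¹ * (2 * d / C) := by
        refine Finset.sum_le_sum fun d hd ↦ ?_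
        exact mul_le_mul_of_nonneg_left (htail d hd) (by positivity)
    _ = ∑ d ∈ h.divisors, 2 / (C : ℝ) := by
        refine Finset.sum_congr rfl fun d hd ↦ ?_
        have hd' : (d : ℝ) ≠ 0 := by exact_mod_cast (Nat.pos_of_mem_divisors hd).ne'
        field_simp
    _ = 2 * (h.divisors.card : ℝ) / C := by
        rw [Finset.sum_const, nsmul_eq_mul]; ring

/-! ### `Σ_m τ(m) m^{-5/4}` -/

/-- `n ↦ n^{-5/4}` is summable over `ℕ`. [folklore] -/
private theorem summable_rpow_neg_five_fourths : Summable (fun n : ℕ ↦ (n : ℝ) ^ (-(5 / 4 : ℝ))) :=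
  Real.summable_nat_rpow.mpr (by norm_num)

/-- `0 ≤ Σ_n n^{-5/4}`. [folklore] -/
private theorem K54_nonneg : 0 ≤ ∑' n : ℕ, (n : ℝ) ^ (-(5 / 4 : ℝ)) :=
  tsum_nonneg fun n ↦ Real.rpow_nonneg (Nat.cast_nonneg n) _

/-- Partial sums: `Σ_{m ≤ M} τ(m) m^{-5/4} ≤ (Σ_n n^{-5/4})²` (hyperbola: `τ(m)m^{-5/4} = Σ_{ef = m} e^{-5/4}f^{-5/4}`).
[folklore] -/
private theorem sum_card_divisors_mul_rpow_le (M : ℕ) :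
    ∑ m ∈ Ioc 0 M, (m.divisors.card : ℝ) * (m : ℝ) ^ (-(5 / 4 : ℝ)) ≤ (∑' n : ℕ, (n : ℝ) ^ (-(5 / 4 : ℝ))) ^ 2 := by
  have h1 : ∀ m ∈ Ioc 0 M, (m.divisors.card : ℝ) * (m : ℝ) ^ (-(5 / 4 : ℝ)) =
      ∑ x ∈ m.divisorsAntidiagonal, (x.1 : ℝ) ^ (-(5 / 4 : ℝ)) * (x.2 : ℝ) ^ (-(5 / 4 : ℝ)) := by
    intro m _
    rw [card_divisors_eq_sum_antidiagonal, Finset.sum_mul]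
    refine Finset.sum_congr rfl fun x hx ↦ ?_
    rw [Nat.mem_divisorsAntidiagonal] at hx
    rw [← hx.1, Nat.cast_mul, Real.mul_rpow (Nat.cast_nonneg _) (Nat.cast_nonneg _), one_mul]
  rw [Finset.sum_congr rfl h1, sum_Ioc_sum_divisorsAntidiagonal_eq
    (fun e f ↦ (e : ℝ) ^ (-(5 / 4 : ℝ)) * (f : ℝ) ^ (-(5 / 4 : ℝ))) M]
  have hS : ∀ N : ℕ, ∑ n ∈ Ioc 0 N, (n : ℝ) ^ (-(5 / 4 : ℝ)) ≤ ∑' n : ℕ, (n : ℝ) ^ (-(5 / 4 : ℝ)) := fun N ↦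
    summable_rpow_neg_five_fourths.sum_le_tsum _ fun n _ ↦ Real.rpow_nonneg (Nat.cast_nonneg n) _
  calc ∑ e ∈ Ioc 0 M, ∑ f ∈ Ioc 0 (M / e), (e : ℝ) ^ (-(5 / 4 : ℝ)) * (f : ℝ) ^ (-(5 / 4 : ℝ))
      ≤ ∑ e ∈ Ioc 0 M, (e : ℝ) ^ (-(5 / 4 : ℝ)) * ∑' n : ℕ, (n : ℝ) ^ (-(5 / 4 : ℝ)) := by
        refine Finset.sum_le_sum fun e _ ↦ ?_
        rw [← Finset.mul_sum]
        exact mul_le_mul_of_nonneg_left (hS _) (Real.rpow_nonneg (Nat.cast_nonneg e) _)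
    _ ≤ (∑' n : ℕ, (n : ℝ) ^ (-(5 / 4 : ℝ))) * ∑' n : ℕ, (n : ℝ) ^ (-(5 / 4 : ℝ)) := by
        rw [← Finset.sum_mul]
        exact mul_le_mul_of_nonneg_right (hS M) K54_nonneg
    _ = (∑' n : ℕ, (n : ℝ) ^ (-(5 / 4 : ℝ))) ^ 2 := (sq _).symm

/-- `Σ_{m ∈ s} τ(m) m^{-5/4} ≤ (Σ_n n^{-5/4})²` for every finite set `s`. [folklore] -/
private theorem sum_card_divisors_mul_rpow_le' (s : Finset ℕ) :
    ∑ m ∈ s, (m.divisors.card : ℝ) * (m : ℝ) ^ (-(5 / 4 : ℝ)) ≤ (∑' n : ℕ, (n : ℝ) ^ (-(5 / 4 : ℝ))) ^ 2 := by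
  classical
  have h0 : ((0 : ℕ).divisors.card : ℝ) * ((0 : ℕ) : ℝ) ^ (-(5 / 4 : ℝ)) = 0 := by simp
  rw [← Finset.sum_erase s h0]
  calc ∑ m ∈ s.erase 0, (m.divisors.card : ℝ) * (m : ℝ) ^ (-(5 / 4 : ℝ))
      ≤ ∑ m ∈ Ioc 0 (s.sup id), (m.divisors.card : ℝ) * (m : ℝ) ^ (-(5 / 4 : ℝ)) := by
        refine Finset.sum_le_sum_of_subset_of_nonneg (fun m hm ↦ ?_)
          (fun m _ _ ↦ mul_nonneg (Nat.cast_nonneg _) (Real.rpow_nonneg (Nat.cast_nonneg m) _))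
        rw [Finset.mem_erase] at hm
        rw [Finset.mem_Ioc]
        exact ⟨Nat.pos_of_ne_zero hm.1, Finset.le_sup (f := id) hm.2⟩
    _ ≤ (∑' n : ℕ, (n : ℝ) ^ (-(5 / 4 : ℝ))) ^ 2 := sum_card_divisors_mul_rpow_le _

/-- `m ↦ τ(m) m^{-5/4}` is summable — the convergence of "`Σ_1^∞ τ(m)|ĝ_m(α)|`" in the proof
of Theorem 4.1 under (4.4)–(4.5). [cite: ConreyIwaniec2002, §4, proof of Theorem 4.1 (expansion of `V_c(α)`)] -/
theorem summable_card_divisors_mul_rpow :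
    Summable (fun m : ℕ ↦ (m.divisors.card : ℝ) * (m : ℝ) ^ (-(5 / 4 : ℝ))) :=
  summable_of_sum_le
    (fun m ↦ mul_nonneg (Nat.cast_nonneg _) (Real.rpow_nonneg (Nat.cast_nonneg m) _))
    sum_card_divisors_mul_rpow_le'

/-- `Σ_{m} τ(m) m^{-5/4} ≤ (Σ_n n^{-5/4})²` — the convergent majorant behind
"`Σ_1^∞ τ(m)|ĝ_m(α)|`" in the proof of Theorem 4.1 ((4.4)–(4.5): `|ψ_m(a)ĝ_m(α)| ≤ (A/c)·BcC·τ(m)m^{-5/4}`).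
[cite: ConreyIwaniec2002, §4, proof of Theorem 4.1 (expansion of `V_c(α)`)] -/
theorem tsum_card_divisors_mul_rpow_le :
    ∑' m : ℕ, (m.divisors.card : ℝ) * (m : ℝ) ^ (-(5 / 4 : ℝ)) ≤ (∑' n : ℕ, (n : ℝ) ^ (-(5 / 4 : ℝ))) ^ 2 :=
  tsum_le_of_sum_le' (sq_nonneg _) sum_card_divisors_mul_rpow_le'

end CircleMethod

end ConreyIwaniec2002

end Literature.NumberTheory.LFunctions

end
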